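import Mathlib

/-!
# `Balaban1983to89.B4Cor23UnitCubeReduction` — T. Bałaban, *Regularity and decay of lattice Green's functions*,
# Commun. Math. Phys. **89** (1983) 571–597 [Balaban1983RegularityDecay], Corollary 2.3, proof p. 581: the reduction of
# an `L²` bilinear bound to pieces supported in unit cubes (Schur test over cubes), PROVED

statement-level skeleton of published theorems with citation tags; proofs where landed; nothing here is a claim about the Yang–Mills mass gap

PDF held: `paper:balaban1983-cmp89-regularity-decay` (journal page = PDF page + 570).

CITATION HEADER (lean-in-tree rule).  lit-balaban cell (HOME `run/shared/lean/pub/lit-balaban/`), Phase-2 proof seat p13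
(SKELETON row `B4.Eq3.10`; this module is the summation half of that proof — split off to respect the cell's 400-line
bound — and serves every "sum over unit cubes" step of the paper: (2.30), (3.10), (5.4)–(5.5)).  THE PRINT (p. 581
[PDF 11], proof of Corollary 2.3, verbatim): *"Of course it is enough to prove it for f, f' with supports in unit cubes,
and the proof proceeds as before using only the L²-bounds of Lemma 2.1."*  WHAT IS REPRODUCED: that sentence as a
theorem, over the plain-vector dictionary of `B4GaugeCovariance`/`B4GaussRep36` (a finite site type `X`; pairings
`f ⬝ᵥ (M *ᵥ f')`, weights absorbed; `‖f‖₂ = √(Σ_x f(x)²)`): the unit cubes are the fibres `{x | cell x = Δ}` of a cell map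
`cell : X → C`, the pieces of a vector are the indicators `Set.indicator {x | cell x = Δ} f = 1_Δ f`, and
`abs_dotProduct_mulVec_le_of_cellwise` says: if every pair of pieces obeys `|⟨1_Δ f, M 1_{Δ'} f'⟩| ≤ B‖1_Δ f‖₂‖1_{Δ'}f'‖₂·
k(Δ,Δ')` for a nonnegative kernel `k` on cubes with row and column sums `≤ K`, then `|⟨f, M f'⟩| ≤ BK‖f‖₂‖f'‖₂` (Schur
test in Cauchy–Schwarz form).  Alongside: the support bookkeeping of the pieces, the bilinear decomposition
`⟨u, Vw⟩ = Σ_{Δ,Δ'} ⟨1_Δ u, V 1_{Δ'} w⟩`, and the duality step `‖1_Δ u‖₂ ≤ B` from `|⟨g,u⟩| ≤ B‖g‖₂ (supp g ⊆ Δ)` by which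
Corollary 2.3 (2.30) is read as a bound on a restricted propagated vector.  No new definition is introduced (Mathlib's
`Set.indicator`, `Real.sqrt`, `dotProduct`); everything is elementary finite-dimensional analysis attached to the
printed reduction; nothing of the paper's analytic content (Lemma 2.1, the random walk expansion) is asserted.
Consumer: `…Balaban1983to89.B4Ineq310Proof` ((3.10) from (3.9)).
-/

namespace Literature.MathematicalPhysics.QuantumFieldTheory.Balaban1983to89.B4Cor23UnitCubeReduction

open Matrix Finset

variable {X C : Type*} (cell : X → C)

/-! ## §1. The pieces `1_Δ f` of a vector on the unit cubes `Δ` -/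

/-- A piece `1_Δ f` of a vector supported in `S` is supported in `S ∩ Δ` (the cube as the site set
`univ.filter (cell · = Δ)`). [cite: Balaban1983RegularityDecay, Cor. 2.3 p.581] -/
theorem indicator_cell_supp [DecidableEq C] {Δ : C} {S : Finset X} {f : X → ℝ} (hf : ∀ x ∉ S, f x = 0) :
    ∀ x ∉ S.filter (fun x => cell x = Δ), Set.indicator {x | cell x = Δ} f x = 0 := by
  intro x hx
  by_cases hxΔ : cell x = Δ
  · rw [Set.indicator_of_mem (show x ∈ {x | cell x = Δ} from hxΔ)]
    exact hf x fun hxS => hx (Finset.mem_filter.mpr ⟨hxS, hxΔ⟩)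
  · exact Set.indicator_of_notMem (show x ∉ {x | cell x = Δ} from hxΔ) f

/-- … and it vanishes when `S ∩ Δ = ∅`. [cite: Balaban1983RegularityDecay, Cor. 2.3 p.581] -/
theorem indicator_cell_eq_zero [DecidableEq C] {Δ : C} {S : Finset X} {f : X → ℝ} (hf : ∀ x ∉ S, f x = 0)
    (h : ¬ (S.filter fun x => cell x = Δ).Nonempty) : Set.indicator {x | cell x = Δ} f = 0 := by
  funext x
  exact indicator_cell_supp cell hf x fun hx => h ⟨x, hx⟩

variable [Fintype X]

/-- `⟨1_Δ u, u⟩ = ‖1_Δ u‖₂²`. [folklore] -/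
private theorem indicator_dotProduct_self (s : Set X) (u : X → ℝ) :
    Set.indicator s u ⬝ᵥ u = √(∑ x, Set.indicator s u x ^ 2) ^ 2 := by
  rw [Real.sq_sqrt (Finset.sum_nonneg fun x _ => sq_nonneg _)]
  unfold dotProduct
  refine Finset.sum_congr rfl fun x _ => ?_
  by_cases hx : x ∈ s
  · rw [Set.indicator_of_mem hx]; ring
  · rw [Set.indicator_of_notMem hx]; ring

/-- DUALITY STEP (how the bilinear bound (2.30) is read on one cube): if `|⟨g, u⟩| ≤ B‖g‖₂` for every `g` supported in
the cube `Δ`, then `‖1_Δ u‖₂ ≤ B`. [cite: Balaban1983RegularityDecay, Cor. 2.3 (2.30) p.581] -/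
theorem sqrt_sum_sq_indicator_le [DecidableEq C] {Δ : C} {u : X → ℝ} {B : ℝ} (hB : 0 ≤ B)
    (h : ∀ g : X → ℝ, (∀ x ∉ univ.filter (fun x => cell x = Δ), g x = 0) → |g ⬝ᵥ u| ≤ B * √(∑ x, g x ^ 2)) :
    √(∑ x, Set.indicator {x | cell x = Δ} u x ^ 2) ≤ B := by
  have hg := h (Set.indicator {x | cell x = Δ} u) fun x hx =>
    Set.indicator_of_notMem (show x ∉ {x | cell x = Δ} from
      fun hxΔ : cell x = Δ => hx (Finset.mem_filter.mpr ⟨Finset.mem_univ x, hxΔ⟩)) u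
  rw [indicator_dotProduct_self, abs_of_nonneg (sq_nonneg _), sq] at hg
  rcases (Real.sqrt_nonneg (∑ x, Set.indicator {x | cell x = Δ} u x ^ 2)).eq_or_lt with h0 | hpos
  · rw [← h0]; exact hB
  · exact le_of_mul_le_mul_right hg hpos

variable [Fintype C]

omit [Fintype X] in
/-- The pieces of a vector add up to the vector: `Σ_Δ 1_Δ u = u`. [folklore] -/
private theorem sum_indicator_cell (u : X → ℝ) : ∑ Δ, Set.indicator {x | cell x = Δ} u = u := by
  funext z
  rw [Finset.sum_apply, Finset.sum_eq_single (cell z)]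
  · exact Set.indicator_of_mem (show z ∈ {x | cell x = cell z} from rfl) u
  · intro Δ _ hne
    exact Set.indicator_of_notMem (show z ∉ {x | cell x = Δ} from fun h : cell z = Δ => hne h.symm) u
  · intro h
    exact absurd (Finset.mem_univ _) h

/-- Bilinear decomposition along the cubes: `⟨u, Vw⟩ = Σ_{Δ,Δ'} ⟨1_Δ u, V 1_{Δ'} w⟩`. [cite: Balaban1983RegularityDecay, Cor. 2.3 p.581] -/
theorem dotProduct_mulVec_indicator_cells (V : Matrix X X ℝ) (u w : X → ℝ) :
    u ⬝ᵥ (V *ᵥ w) =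
      ∑ Δ, ∑ Δ', Set.indicator {x | cell x = Δ} u ⬝ᵥ (V *ᵥ Set.indicator {x | cell x = Δ'} w) := by
  calc u ⬝ᵥ (V *ᵥ w)
      = (∑ Δ, Set.indicator {x | cell x = Δ} u) ⬝ᵥ (V *ᵥ ∑ Δ', Set.indicator {x | cell x = Δ'} w) := by
        rw [sum_indicator_cell, sum_indicator_cell]
    _ = ∑ Δ, ∑ Δ', Set.indicator {x | cell x = Δ} u ⬝ᵥ (V *ᵥ Set.indicator {x | cell x = Δ'} w) := by
        rw [sum_dotProduct]
        refine Finset.sum_congr rfl fun Δ _ => ?_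
        rw [Matrix.mulVec_sum, dotProduct_sum]

/-- `Σ_Δ ‖1_Δ f‖₂² = ‖f‖₂²`. [folklore] -/
private theorem sum_sq_indicator_cells (f : X → ℝ) :
    ∑ Δ, √(∑ x, Set.indicator {x | cell x = Δ} f x ^ 2) ^ 2 = ∑ x, f x ^ 2 := by
  calc ∑ Δ, √(∑ x, Set.indicator {x | cell x = Δ} f x ^ 2) ^ 2
      = ∑ Δ, ∑ x, Set.indicator {x | cell x = Δ} f x ^ 2 :=
        Finset.sum_congr rfl fun Δ _ => Real.sq_sqrt (Finset.sum_nonneg fun x _ => sq_nonneg _)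
    _ = ∑ x, ∑ Δ, Set.indicator {x | cell x = Δ} f x ^ 2 := Finset.sum_comm
    _ = ∑ x, f x ^ 2 := Finset.sum_congr rfl fun x _ => by
        rw [Finset.sum_eq_single (cell x)]
        · rw [Set.indicator_of_mem (show x ∈ {y | cell y = cell x} from rfl)]
        · intro Δ _ hne
          rw [Set.indicator_of_notMem (show x ∉ {y | cell y = Δ} from fun h : cell x = Δ => hne h.symm)]
          ring
        · intro h
          exact absurd (Finset.mem_univ _) h

/-! ## §2. The summation over cubes: Schur test and the unit-cube reduction -/

/-- Schur test in Cauchy–Schwarz form: a nonnegative kernel with row and column sums `≤ K` satisfies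
`Σ_{i,j} aᵢ bⱼ k(i,j) ≤ K (Σ aᵢ²)^{1/2} (Σ bⱼ²)^{1/2}`. [folklore] -/
private theorem schur_l2 {ι : Type*} [Fintype ι] (k : ι → ι → ℝ) (hk : ∀ i j, 0 ≤ k i j) (K : ℝ)
    (hrow : ∀ i, ∑ j, k i j ≤ K) (hcol : ∀ j, ∑ i, k i j ≤ K) (a b : ι → ℝ) :
    ∑ i, ∑ j, a i * b j * k i j ≤ K * √(∑ i, a i ^ 2) * √(∑ j, b j ^ 2) := by
  rcases isEmpty_or_nonempty ι with hι | hι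
  · simp
  have hK : 0 ≤ K := le_trans (Finset.sum_nonneg fun j _ => hk (Classical.arbitrary ι) j) (hrow _)
  -- the inner sums `cᵢ = Σ_j bⱼ k(i,j)`: `cᵢ² ≤ K Σ_j bⱼ² k(i,j)` (Cauchy–Schwarz with the weights `k(i,j)`)
  have hc : ∀ i, (∑ j, b j * k i j) ^ 2 ≤ K * ∑ j, b j ^ 2 * k i j := by
    intro i
    have hcs := Finset.sum_mul_sq_le_sq_mul_sq Finset.univ (fun j => √(k i j)) (fun j => b j * √(k i j))
    have e1 : ∑ j, √(k i j) * (b j * √(k i j)) = ∑ j, b j * k i j := by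
      refine Finset.sum_congr rfl fun j _ => ?_
      have := Real.mul_self_sqrt (hk i j)
      calc √(k i j) * (b j * √(k i j)) = b j * (√(k i j) * √(k i j)) := by ring
        _ = b j * k i j := by rw [this]
    have e2 : ∑ j, √(k i j) ^ 2 = ∑ j, k i j := Finset.sum_congr rfl fun j _ => Real.sq_sqrt (hk i j)
    have e3 : ∑ j, (b j * √(k i j)) ^ 2 = ∑ j, b j ^ 2 * k i j :=
      Finset.sum_congr rfl fun j _ => by rw [mul_pow, Real.sq_sqrt (hk i j)]
    rw [e1, e2, e3] at hcs
    exact hcs.trans (mul_le_mul_of_nonneg_right (hrow i)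
      (Finset.sum_nonneg fun j _ => mul_nonneg (sq_nonneg _) (hk i j)))
  have hsumc : ∑ i, (∑ j, b j * k i j) ^ 2 ≤ K ^ 2 * ∑ j, b j ^ 2 := by
    calc ∑ i, (∑ j, b j * k i j) ^ 2 ≤ ∑ i, K * ∑ j, b j ^ 2 * k i j := Finset.sum_le_sum fun i _ => hc i
      _ = K * ∑ j, b j ^ 2 * ∑ i, k i j := by
          rw [← Finset.mul_sum, Finset.sum_comm]
          congr 1
          exact Finset.sum_congr rfl fun j _ => by rw [Finset.mul_sum]
      _ ≤ K * ∑ j, b j ^ 2 * K := by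
          apply mul_le_mul_of_nonneg_left _ hK
          exact Finset.sum_le_sum fun j _ => mul_le_mul_of_nonneg_left (hcol j) (sq_nonneg _)
      _ = K ^ 2 * ∑ j, b j ^ 2 := by rw [← Finset.sum_mul]; ring
  have e4 : ∑ i, ∑ j, a i * b j * k i j = ∑ i, a i * ∑ j, b j * k i j := by
    refine Finset.sum_congr rfl fun i _ => ?_
    rw [Finset.mul_sum]
    exact Finset.sum_congr rfl fun j _ => by ring
  rw [e4]
  calc ∑ i, a i * ∑ j, b j * k i j
      ≤ √(∑ i, a i ^ 2) * √(∑ i, (∑ j, b j * k i j) ^ 2) := Real.sum_mul_le_sqrt_mul_sqrt _ _ _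
    _ ≤ √(∑ i, a i ^ 2) * √(K ^ 2 * ∑ j, b j ^ 2) := by gcongr
    _ = K * √(∑ i, a i ^ 2) * √(∑ j, b j ^ 2) := by
        rw [Real.sqrt_mul (sq_nonneg K), Real.sqrt_sq hK]
        ring

/-- **THE UNIT-CUBE REDUCTION** (p. 581 [PDF 11], verbatim: *"Of course it is enough to prove it for f, f' with
supports in unit cubes, and the proof proceeds as before using only the L²-bounds of Lemma 2.1."*), as a theorem over
plain vectors: if every pair of pieces satisfies `|⟨1_Δ f, M 1_{Δ'} f'⟩| ≤ B‖1_Δ f‖₂‖1_{Δ'} f'‖₂·k(Δ,Δ')` for a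
nonnegative kernel `k` on the cubes whose row and column sums are `≤ K`, then `|⟨f, M f'⟩| ≤ BK‖f‖₂‖f'‖₂`
(`‖f‖₂ = √(Σ_x f(x)²)`). [cite: Balaban1983RegularityDecay, Cor. 2.3 p.581] -/
theorem abs_dotProduct_mulVec_le_of_cellwise (M : Matrix X X ℝ) (k : C → C → ℝ) (hk : ∀ i j, 0 ≤ k i j)
    (K B : ℝ) (hB : 0 ≤ B) (hrow : ∀ i, ∑ j, k i j ≤ K) (hcol : ∀ j, ∑ i, k i j ≤ K) (f f' : X → ℝ)
    (h : ∀ Δ Δ', |Set.indicator {x | cell x = Δ} f ⬝ᵥ (M *ᵥ Set.indicator {x | cell x = Δ'} f')| ≤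
      B * (√(∑ x, Set.indicator {x | cell x = Δ} f x ^ 2) * √(∑ x, Set.indicator {x | cell x = Δ'} f' x ^ 2) *
        k Δ Δ')) :
    |f ⬝ᵥ (M *ᵥ f')| ≤ B * K * √(∑ x, f x ^ 2) * √(∑ x, f' x ^ 2) := by
  rw [dotProduct_mulVec_indicator_cells cell M f f']
  calc |∑ Δ, ∑ Δ', Set.indicator {x | cell x = Δ} f ⬝ᵥ (M *ᵥ Set.indicator {x | cell x = Δ'} f')|
      ≤ ∑ Δ, |∑ Δ', Set.indicator {x | cell x = Δ} f ⬝ᵥ (M *ᵥ Set.indicator {x | cell x = Δ'} f')| :=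
        Finset.abs_sum_le_sum_abs _ _
    _ ≤ ∑ Δ, ∑ Δ', |Set.indicator {x | cell x = Δ} f ⬝ᵥ (M *ᵥ Set.indicator {x | cell x = Δ'} f')| :=
        Finset.sum_le_sum fun Δ _ => Finset.abs_sum_le_sum_abs _ _
    _ ≤ ∑ Δ, ∑ Δ', B * (√(∑ x, Set.indicator {x | cell x = Δ} f x ^ 2) *
          √(∑ x, Set.indicator {x | cell x = Δ'} f' x ^ 2) * k Δ Δ') :=
        Finset.sum_le_sum fun Δ _ => Finset.sum_le_sum fun Δ' _ => h Δ Δ'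
    _ = B * ∑ Δ, ∑ Δ', √(∑ x, Set.indicator {x | cell x = Δ} f x ^ 2) *
          √(∑ x, Set.indicator {x | cell x = Δ'} f' x ^ 2) * k Δ Δ' := by
        rw [Finset.mul_sum]
        exact Finset.sum_congr rfl fun Δ _ => by rw [Finset.mul_sum]
    _ ≤ B * (K * √(∑ Δ, √(∑ x, Set.indicator {x | cell x = Δ} f x ^ 2) ^ 2) *
          √(∑ Δ', √(∑ x, Set.indicator {x | cell x = Δ'} f' x ^ 2) ^ 2)) :=
        mul_le_mul_of_nonneg_left (schur_l2 k hk K hrow hcol _ _) hB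
    _ = B * K * √(∑ x, f x ^ 2) * √(∑ x, f' x ^ 2) := by
        rw [sum_sq_indicator_cells, sum_sq_indicator_cells]
        ring

end Literature.MathematicalPhysics.QuantumFieldTheory.Balaban1983to89.B4Cor23UnitCubeReduction
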